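import Summits.CriticalPhenomena.Ising3DConformalLimit.Theses.ArmHyperscaling
import Literature.Probability.LatticeModels.OnsagerYang
import Literature.Probability.LatticeModels.GHSTruncatedPair
import Literature.Probability.LatticeModels.BoxTwoPointTransfer
import Literature.Probability.LatticeModels.SharpnessProofs
import Literature.Probability.LatticeModels.PlusStateFKG
import HarnessLib

/-!
# One-arm hyperscaling ⟹ two-point `+`-boundary forgetting (the GHS converse of `ForgettingGivesOneArm`)

Route `ArmHyperscaling` (sub-problem `CriticalPhenomena/Ising3DConformalLimit`). The support item
stmt-CriticalPhenomena-15595 `ForgettingGivesOneArm` (landed: `forgettingGivesOneArm_proof`) says that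
two-point `+`-boundary forgetting at ONE macroscopic ratio `K ≥ 3`,

  `(F)  ∃ K ≥ 3, ∃ C, ∀ n ≥ 1:  ⟨σ₀σ_{2ne₁}⟩⁺_{Λ_{Kn};β_c,0} ≤ C·⟨σ₀σ_{2ne₁}⟩⁺_{β_c,0}`

(the order-2, one-shape instance of route BallOrbitComparison's `UniformBoundaryForgetting`), implies
the crux stmt-CriticalPhenomena-15591 `OneArmHyperscaling`. Its route text remarks that the converse
"one-arm ⟹ forgetting, is GHS … not filed". This file proves that converse
(`forgetting_of_oneArmHyperscaling`), so that — together with the landed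
`ArmHyperscalingForgetting.forgettingGivesOneArm_proof` (Theorems/ArmHyperscalingForgettingGivesOneArm.lean,
not imported here to keep this file out of that module's cone) — `(F)` and `OneArmHyperscaling` are
EQUIVALENT by name in the kernel: the forgetting door to the one-arm crux is a re-dressing of it at
the same strength, not a weakening.

Proof (`z = 2ne₁`, `Λ = Λ_{(K+2)n}`, `K ≥ 1` the one-arm ratio): by GHS (Lebowitz 1974, Remark (ii);
tree `isingCorr_pair_trunc_plus_le_free`) `⟨σ₀σ_z⟩⁺_Λ ≤ ⟨σ₀σ_z⟩^∅_Λ + ⟨σ₀⟩⁺_Λ⟨σ_z⟩⁺_Λ`; by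
Griffiths II the free pair function increases with the volume and the free state lies below the plus
state, `⟨σ₀σ_z⟩^∅_Λ ≤ ⟨σ₀σ_z⟩^∅_{β_c} ≤ ⟨σ₀σ_z⟩⁺_{β_c}` (tree `isingTwoPoint_box_le_twoPointFree`,
`twoPointFree_le_twoPointPlus_holds`); plus magnetisations are antitone in the volume and
`Λ_{Kn} ⊆ Λ`, `z + Λ_{Kn} ⊆ Λ`, so `⟨σ₀⟩⁺_Λ, ⟨σ_z⟩⁺_Λ ≤ m⁺_{Kn}` (translation covariance); finally
`(m⁺_{Kn})² ≤ C·⟨σ₀σ_z⟩⁺_{β_c}` is the one-arm input. Hence `(F)` with ratio `K+2` and constant `C+1`.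

References: J. L. Lebowitz, Comm. Math. Phys. 35 (1974) 87, eq. (1.8), §2 Remark (ii);
S. Friedli, Y. Velenik, *Statistical Mechanics of Lattice Systems* (CUP 2017), Thm. 3.20,
Exercises 3.12, 3.25, proof of Thm. 3.17.
-/

noncomputable section

namespace Summit.CriticalPhenomena.Ising3DConformalLimit.ArmHyperscalingForgettingConverse

open Literature.Probability.LatticeModels Finset

/-- `2n e₁ + Λ_{Kn} ⊆ Λ_{(K+2)n}`: the translate by the axis point `2n e₁` of the box of radius `Kn`
lies in the box of radius `(K+2)n`. [folklore] -/
theorem map_shift_box_subset_box (K n : ℕ) :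
    (box 3 (K * n)).map (Site.shift (Pi.single 0 (2 * (n : ℤ)) : Site 3)).toEmbedding ⊆
      box 3 ((K + 2) * n) := by
  intro y hy
  rw [mem_map_shift_iff', mem_box] at hy
  rw [mem_box]
  intro i
  have hyi := hy i
  have hcast : (((K + 2) * n : ℕ) : ℤ) = ((K * n : ℕ) : ℤ) + 2 * n := by push_cast; ring
  by_cases hi : i = 0
  · subst hi
    simp only [Pi.sub_apply, Pi.single_eq_same] at hyi
    constructor <;> omega
  · simp only [Pi.sub_apply, Pi.single_apply, hi, if_false, sub_zero] at hyi
    constructor <;> omega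

/-- **Volume antitonicity at the axis point**: `⟨σ_{2ne₁}⟩⁺_{Λ_{(K+2)n};β_c,0} ≤ m⁺_{Kn}` — the plus
magnetisation at `z = 2ne₁` in the big box is at most the one in the translated small box `z + Λ_{Kn}`
(`isingCorr_plus_le_of_subset`), which is the centre magnetisation of `Λ_{Kn}` by translation
covariance. [cite: FriedliVelenik2017, Exercise 3.12 and Thm. 3.17 (proof), p. 113] -/
theorem plusMag_axisPoint_le_boxMag (K n : ℕ) :
    isingCorr (zdGraph 3) (box 3 ((K + 2) * n)) (criticalBeta 3) 0 .plus
        ({Pi.single 0 (2 * (n : ℤ))} : Finset (Site 3)) ≤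
      isingCorr (zdGraph 3) (box 3 (K * n)) (criticalBeta 3) 0 .plus ({0} : Finset (Site 3)) := by
  set z : Site 3 := Pi.single 0 (2 * (n : ℤ)) with hz
  have hβ : 0 ≤ criticalBeta 3 := criticalBeta_nonneg 3
  have hzsub : ({z} : Finset (Site 3)) ⊆ (box 3 (K * n)).map (Site.shift z).toEmbedding := by
    rw [Finset.singleton_subset_iff, mem_map_shift_iff', sub_self]
    exact zero_mem_box 3 _
  have h := isingCorr_plus_le_of_subset (zdGraph 3) hβ le_rfl hzsub (map_shift_box_subset_box K n)
  -- translation covariance: the magnetisation at the centre `z` of `z + Λ_{Kn}` is `m⁺_{Kn}`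
  have hmap := isingCorr_plus_map_shift z (box 3 (K * n)) ({0} : Finset (Site 3)) (criticalBeta 3) 0
  rw [Finset.map_singleton] at hmap
  have hz0 : (Site.shift z).toEmbedding (0 : Site 3) = z := by simp
  rw [hz0] at hmap
  rwa [hmap] at h

/-- **Volume antitonicity at the centre**: `⟨σ₀⟩⁺_{Λ_{(K+2)n};β_c,0} ≤ m⁺_{Kn}` (`Λ_{Kn} ⊆ Λ_{(K+2)n}`,
`isingCorr_plus_le_of_subset`). [cite: FriedliVelenik2017, Exercise 3.12] -/
theorem plusMag_center_le_boxMag (K n : ℕ) :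
    isingCorr (zdGraph 3) (box 3 ((K + 2) * n)) (criticalBeta 3) 0 .plus ({0} : Finset (Site 3)) ≤
      isingCorr (zdGraph 3) (box 3 (K * n)) (criticalBeta 3) 0 .plus ({0} : Finset (Site 3)) :=
  isingCorr_plus_le_of_subset (zdGraph 3) (criticalBeta_nonneg 3) le_rfl
    (Finset.singleton_subset_iff.2 (zero_mem_box 3 _))
    (box_mono 3 (Nat.mul_le_mul_right n (Nat.le_add_right K 2)))

/-- **Free box pair function below the critical two-point function**: for `z ≠ 0` in the box `Λ_L`,
`⟨σ₀σ_z⟩^∅_{Λ_L;β_c,0} ≤ ⟨σ₀σ_z⟩^∅_{β_c,0} ≤ ⟨σ₀σ_z⟩⁺_{β_c,0}` (Griffiths II: the free pair function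
increases with the volume; the plus state dominates the free state on pair functions at zero field).
[cite: FriedliVelenik2017, Exercise 3.12, Exercise 3.25] -/
theorem freeBoxPair_le_criticalTwoPoint {L : ℕ} {z : Site 3} (hz : z ∈ box 3 L) (hz0 : z ≠ 0) :
    isingCorr (zdGraph 3) (box 3 L) (criticalBeta 3) 0 .free ({0, z} : Finset (Site 3)) ≤
      criticalTwoPoint 3 z := by
  have hβ : 0 ≤ criticalBeta 3 := criticalBeta_nonneg 3
  have h1 := isingTwoPoint_box_le_twoPointFree hβ (zero_mem_box 3 L) hz
  rw [isingTwoPoint_eq_isingCorr (zdGraph 3) _ _ _ _ hz0.symm, sub_zero] at h1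
  have h2 : twoPointFree 3 (criticalBeta 3) z ≤ twoPointPlus 3 (criticalBeta 3) z :=
    twoPointFree_le_twoPointPlus_holds (by norm_num) hβ z
  show _ ≤ twoPointPlus 3 (criticalBeta 3) z
  exact h1.trans h2

/-- **GHS decomposition of the plus box pair function** (`n ≥ 1`, `z = 2ne₁`, any `K`):
`⟨σ₀σ_z⟩⁺_{Λ_{(K+2)n};β_c,0} ≤ ⟨σ₀σ_z⟩⁺_{β_c,0} + (m⁺_{Kn})²` — GHS
(`⟨σ₀σ_z⟩⁺_Λ − ⟨σ₀⟩⁺_Λ⟨σ_z⟩⁺_Λ ≤ ⟨σ₀σ_z⟩^∅_Λ`, Lebowitz 1974 Remark (ii)), the free box pair below the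
critical two-point function, and both plus magnetisations of the big box below `m⁺_{Kn}`.
[cite: Lebowitz1974, eq. (1.8), §2 Remark (ii)] -/
theorem plusBoxPair_le_criticalTwoPoint_add_boxMag_sq (K : ℕ) {n : ℕ} (hn : 1 ≤ n) :
    isingCorr (zdGraph 3) (box 3 ((K + 2) * n)) (criticalBeta 3) 0 .plus
        ({0, Pi.single 0 (2 * (n : ℤ))} : Finset (Site 3)) ≤
      criticalTwoPoint 3 (Pi.single 0 (2 * (n : ℤ))) +
        isingCorr (zdGraph 3) (box 3 (K * n)) (criticalBeta 3) 0 .plus ({0} : Finset (Site 3)) ^ 2 := by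
  set z : Site 3 := Pi.single 0 (2 * (n : ℤ)) with hz
  have hβ : 0 ≤ criticalBeta 3 := criticalBeta_nonneg 3
  have hzΛ : z ∈ box 3 ((K + 2) * n) := by
    refine map_shift_box_subset_box K n ?_
    rw [mem_map_shift_iff', sub_self]
    exact zero_mem_box 3 _
  have h0Λ : (0 : Site 3) ∈ box 3 ((K + 2) * n) := zero_mem_box 3 _
  have hz0 : z ≠ 0 := by
    intro h
    have h' := congr_fun h 0
    simp only [hz, Pi.single_eq_same, Pi.zero_apply] at h'
    omega
  -- GHS: truncated plus pair ≤ free pair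
  have hghs := isingCorr_pair_trunc_plus_le_free (zdGraph 3) hβ h0Λ hzΛ hz0.symm
  -- free box pair ≤ critical two-point function
  have hfree := freeBoxPair_le_criticalTwoPoint hzΛ hz0
  -- both one-point functions of the big box are ≤ m⁺_{Kn}, and nonnegative (GKS I)
  have hm0 := plusMag_center_le_boxMag K n
  have hmz := plusMag_axisPoint_le_boxMag K n
  have hmz_nonneg : 0 ≤ isingCorr (zdGraph 3) (box 3 ((K + 2) * n)) (criticalBeta 3) 0 .plus
      ({z} : Finset (Site 3)) :=
    GKSInequalities.gks_one_holds (zdGraph 3) hβ le_rfl (Or.inr rfl) (Finset.singleton_subset_iff.2 hzΛ)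
  have hm_nonneg : 0 ≤ isingCorr (zdGraph 3) (box 3 (K * n)) (criticalBeta 3) 0 .plus
      ({0} : Finset (Site 3)) :=
    GKSInequalities.gks_one_holds (zdGraph 3) hβ le_rfl (Or.inr rfl)
      (Finset.singleton_subset_iff.2 (zero_mem_box 3 _))
  have hprod : isingCorr (zdGraph 3) (box 3 ((K + 2) * n)) (criticalBeta 3) 0 .plus ({0} : Finset (Site 3)) *
      isingCorr (zdGraph 3) (box 3 ((K + 2) * n)) (criticalBeta 3) 0 .plus ({z} : Finset (Site 3)) ≤
      isingCorr (zdGraph 3) (box 3 (K * n)) (criticalBeta 3) 0 .plus ({0} : Finset (Site 3)) ^ 2 := by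
    rw [sq]
    exact mul_le_mul hm0 hmz hmz_nonneg hm_nonneg
  linarith

/-- **One-arm hyperscaling ⟹ two-point `+`-boundary forgetting at one ratio** (the GHS converse of
item stmt-CriticalPhenomena-15595): if `OneArmHyperscaling` holds with ratio `K` and constant `C`, then
`⟨σ₀σ_{2ne₁}⟩⁺_{Λ_{(K+2)n};β_c,0} ≤ (C+1)·⟨σ₀σ_{2ne₁}⟩⁺_{β_c,0}` for all `n ≥ 1`, i.e. the hypothesis of
`ForgettingGivesOneArm` holds with ratio `K + 2 ≥ 3`. [cite: Lebowitz1974, eq. (1.8), §2 Remark (ii)] -/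
theorem forgetting_of_oneArmHyperscaling
    (h : Summit.CriticalPhenomena.Ising3DConformalLimit.Theses.ArmHyperscaling.OneArmHyperscaling) :
    ∃ K : ℕ, 3 ≤ K ∧ ∃ C : ℝ, ∀ n : ℕ, 1 ≤ n →
      isingCorr (zdGraph 3) (box 3 (K * n)) (criticalBeta 3) 0 .plus
          ({0, Pi.single 0 (2 * (n : ℤ))} : Finset (Site 3)) ≤
        C * criticalTwoPoint 3 (Pi.single 0 (2 * (n : ℤ))) := by
  obtain ⟨K, hK, C, hC⟩ := h
  refine ⟨K + 2, by omega, C + 1, fun n hn => ?_⟩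
  have h1 := plusBoxPair_le_criticalTwoPoint_add_boxMag_sq K hn
  have h2 := hC n hn
  linarith

end Summit.CriticalPhenomena.Ising3DConformalLimit.ArmHyperscalingForgettingConverse

end
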